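import Mathlib
import Summits.NavierStokesRegularity.NavierStokesRegularity.Theorems.FilamentSkeletonRssKelvinGateTightnessSpikeTools

/-!
# Route `FilamentSkeletonRss` · crux `TransverseReductionRJ` (stmt-NavierStokesRegularity-21221) — line `kelvin_gate`, stub S3
# `NonlinearClosingFrom`: tools for the «spike functional» witness (part 2 of 3: the oscillating data family)

Helper file (theorems only, `--supports stmt-NavierStokesRegularity-21221`).  HONEST FRAMING as in part 1
(`…KelvinGateTightnessSpikeTools`): MODEL rung, negative side, ASIDE item; nothing here bears on Navier–Stokes regularity; no
registered stub is proved or refuted.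

THIS FILE: the data family `G(y) = (a·cos(k⟪e,y⟫)·Φ(y))·e` (`Φ` a smooth bump on `ℝ³`, `e` a unit vector): smoothness, its
derivative and pointwise sizes, a uniform `Y`-bound when `|a| ≤ 1`, `|a||k| ≤ 1` (`dataField_yBound`), sup-norm closeness of two
members (`dataField_close`), the value of the spike functional of part 1 on the member of MATCHING frequency
(`spike_on_data`: `= −∫ φ sin²(kt)` when `a·k = 1`), and the window bound `∫ φ sin²(kt) ≥ 1/2` for `k ≥ 2π` when `φ = 1` on
`[−1,1]` (`half_le_integral_bump_sin_sq`).
-/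

set_option linter.dupNamespace false

noncomputable section

namespace Summit.NavierStokesRegularity.NavierStokesRegularity.Theorems.KelvinGate

open Set Function Filter MeasureTheory Topology Real
open scoped InnerProductSpace FourierTransform

/-! ## §2  The data family `G_p(y) = a·cos(k⟪e,y⟫)·Φ(y)·e` -/

/-- The data field is smooth. [folklore] -/
theorem dataField_contDiff (Φ : ContDiffBump (0 : EuclideanSpace ℝ (Fin 3))) (a k : ℝ) (e : EuclideanSpace ℝ (Fin 3))
    {n : ℕ∞} : ContDiff ℝ n (fun y : EuclideanSpace ℝ (Fin 3) => (a * Real.cos (k * ⟪e, y⟫_ℝ) * Φ y) • e) :=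
  ((contDiff_const.mul ((contDiff_const.mul (contDiff_const.inner ℝ contDiff_id)).cos)).mul Φ.contDiff).smul
    contDiff_const

/-- The derivative of the data field and its size. [folklore] -/
theorem dataField_hasFDerivAt (Φ : ContDiffBump (0 : EuclideanSpace ℝ (Fin 3))) (a k : ℝ) (e y : EuclideanSpace ℝ (Fin 3)) :
    HasFDerivAt (fun y : EuclideanSpace ℝ (Fin 3) => (a * Real.cos (k * ⟪e, y⟫_ℝ) * Φ y) • e)
      (((a * Real.cos (k * ⟪e, y⟫_ℝ)) • fderiv ℝ Φ y +
        Φ y • (a • (-Real.sin (k * ⟪e, y⟫_ℝ) • (k • innerSL ℝ e)))).smulRight e) y := by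
  have h1 : HasFDerivAt (fun y : EuclideanSpace ℝ (Fin 3) => k * ⟪e, y⟫_ℝ) (k • innerSL ℝ e) y :=
    (innerSL ℝ e).hasFDerivAt.const_mul k
  have h2 := h1.cos
  have h3 : HasFDerivAt (fun y : EuclideanSpace ℝ (Fin 3) => a * Real.cos (k * ⟪e, y⟫_ℝ))
      (a • (-Real.sin (k * ⟪e, y⟫_ℝ) • (k • innerSL ℝ e))) y := h2.const_mul a
  have h4 : HasFDerivAt (Φ : EuclideanSpace ℝ (Fin 3) → ℝ) (fderiv ℝ Φ y) y :=
    (((Φ.contDiff (n := 1)).differentiable one_ne_zero) y).hasFDerivAt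
  exact (h3.mul h4).smul_const e

/-- Pointwise sizes of the data field: value `≤ |a|`, derivative `≤ |a|·‖DΦ‖ + |a|·|k|` (for `‖e‖ = 1`), both vanishing off
the support of `Φ`. [folklore] -/
theorem dataField_bounds (Φ : ContDiffBump (0 : EuclideanSpace ℝ (Fin 3))) (a k : ℝ) {e : EuclideanSpace ℝ (Fin 3)}
    (he : ‖e‖ = 1) {M : ℝ} (hM : ∀ y, ‖fderiv ℝ (Φ : EuclideanSpace ℝ (Fin 3) → ℝ) y‖ ≤ M) (y : EuclideanSpace ℝ (Fin 3)) :
    ‖(a * Real.cos (k * ⟪e, y⟫_ℝ) * Φ y) • e‖ ≤ |a| ∧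
    ‖fderiv ℝ (fun y : EuclideanSpace ℝ (Fin 3) => (a * Real.cos (k * ⟪e, y⟫_ℝ) * Φ y) • e) y‖ ≤ |a| * M + |a| * |k| ∧
    (Φ.rOut < ‖y‖ → (a * Real.cos (k * ⟪e, y⟫_ℝ) * Φ y) • e = 0 ∧
      fderiv ℝ (fun y : EuclideanSpace ℝ (Fin 3) => (a * Real.cos (k * ⟪e, y⟫_ℝ) * Φ y) • e) y = 0) := by
  have hΦ1 : |Φ y| ≤ 1 := by rw [abs_of_nonneg Φ.nonneg]; exact Φ.le_one
  have hcos : |Real.cos (k * ⟪e, y⟫_ℝ)| ≤ 1 := Real.abs_cos_le_one _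
  refine ⟨?_, ?_, ?_⟩
  · rw [norm_smul, he, mul_one, Real.norm_eq_abs, abs_mul, abs_mul]
    calc |a| * |Real.cos (k * ⟪e, y⟫_ℝ)| * |Φ y| ≤ |a| * 1 * 1 :=
          mul_le_mul (mul_le_mul_of_nonneg_left hcos (abs_nonneg _)) hΦ1 (abs_nonneg _) (by positivity)
      _ = |a| := by ring
  · rw [(dataField_hasFDerivAt Φ a k e y).fderiv, ContinuousLinearMap.norm_smulRight_apply, he, mul_one]
    refine le_trans (norm_add_le _ _) (add_le_add ?_ ?_)
    · rw [norm_smul, Real.norm_eq_abs, abs_mul]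
      calc |a| * |Real.cos (k * ⟪e, y⟫_ℝ)| * ‖fderiv ℝ (Φ : EuclideanSpace ℝ (Fin 3) → ℝ) y‖ ≤ |a| * 1 * M :=
            mul_le_mul (mul_le_mul_of_nonneg_left hcos (abs_nonneg _)) (hM y) (norm_nonneg _) (by positivity)
        _ = |a| * M := by ring
    · rw [norm_smul, norm_smul, norm_smul, norm_smul, Real.norm_eq_abs, Real.norm_eq_abs, Real.norm_eq_abs,
        Real.norm_eq_abs, abs_neg, innerSL_apply_norm, he, mul_one]
      have hsin : |Real.sin (k * ⟪e, y⟫_ℝ)| ≤ 1 := Real.abs_sin_le_one _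
      calc |Φ y| * (|a| * (|Real.sin (k * ⟪e, y⟫_ℝ)| * |k|)) ≤ 1 * (|a| * (1 * |k|)) :=
            mul_le_mul hΦ1 (mul_le_mul_of_nonneg_left (mul_le_mul_of_nonneg_right hsin (abs_nonneg _)) (abs_nonneg _))
              (by positivity) zero_le_one
        _ = |a| * |k| := by ring
  · intro hy
    have hdist : Φ.rOut ≤ dist y 0 := by rw [dist_zero_right]; exact le_of_lt hy
    have h0 : Φ y = 0 := Φ.zero_of_le_dist hdist
    have h1 : fderiv ℝ (Φ : EuclideanSpace ℝ (Fin 3) → ℝ) y = 0 := by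
      have hnot : y ∉ tsupport (Φ : EuclideanSpace ℝ (Fin 3) → ℝ) := by
        rw [Φ.tsupport_eq, Metric.mem_closedBall, dist_zero_right]
        exact not_le.mpr hy
      exact fderiv_of_notMem_tsupport ℝ hnot
    refine ⟨by rw [h0]; simp, ?_⟩
    rw [(dataField_hasFDerivAt Φ a k e y).fderiv, h0, h1]; simp


/-- The spike integrand is integrable for `C¹` data. [folklore] -/
theorem spike_integrable (φ : ContDiffBump (0:ℝ)) (k : ℝ) {F : EuclideanSpace ℝ (Fin 3) → EuclideanSpace ℝ (Fin 3)}
    (hF : ContDiff ℝ 1 F) (e : EuclideanSpace ℝ (Fin 3)) :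
    Integrable (fun t => φ t * Real.sin (k * t) * ⟪fderiv ℝ F (t • e) e, e⟫_ℝ) := by
  have hcv' : Continuous (fun t : ℝ => ⟪fderiv ℝ F (t • e) e, e⟫_ℝ) := by
    have h1 : Continuous (fun t : ℝ => fderiv ℝ F (t • e)) :=
      (hF.continuous_fderiv one_ne_zero).comp (continuous_id.smul continuous_const)
    exact (h1.clm_apply continuous_const).inner continuous_const
  exact ((φ.continuous.mul (Real.continuous_sin.comp (continuous_const.mul continuous_id))).mul hcv').integrable_of_hasCompactSupport
    (φ.hasCompactSupport.mul_right.mul_right)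

/-- A uniform `Y`-bound for the data field when `|a| ≤ 1`, `|a|·|k| ≤ 1`. [folklore] -/
theorem dataField_yBound (Φ : ContDiffBump (0 : EuclideanSpace ℝ (Fin 3))) {a k : ℝ} {e : EuclideanSpace ℝ (Fin 3)}
    (he : ‖e‖ = 1) {M : ℝ} (hM : ∀ y, ‖fderiv ℝ (Φ : EuclideanSpace ℝ (Fin 3) → ℝ) y‖ ≤ M) (hM0 : 0 ≤ M)
    (ha : |a| ≤ 1) (hak : |a| * |k| ≤ 1) :
    YBound (fun y : EuclideanSpace ℝ (Fin 3) => (a * Real.cos (k * ⟪e, y⟫_ℝ) * Φ y) • e) ((1 + Φ.rOut) ^ 2 * (M + 1)) := by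
  refine ⟨dataField_contDiff Φ a k e, fun y => ?_⟩
  obtain ⟨hv, hd, hz⟩ := dataField_bounds Φ a k he hM y
  by_cases hy : ‖y‖ ≤ Φ.rOut
  · have hw : (1 + ‖y‖) ^ 2 ≤ (1 + Φ.rOut) ^ 2 := by nlinarith [norm_nonneg y]
    have hv' : ‖(a * Real.cos (k * ⟪e, y⟫_ℝ) * Φ y) • e‖ ≤ M + 1 := by linarith
    have hd' : ‖fderiv ℝ (fun y : EuclideanSpace ℝ (Fin 3) => (a * Real.cos (k * ⟪e, y⟫_ℝ) * Φ y) • e) y‖ ≤ M + 1 := by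
      have : |a| * M ≤ 1 * M := mul_le_mul_of_nonneg_right ha hM0
      linarith
    have hR : 0 ≤ (1 + Φ.rOut) ^ 2 := by positivity
    exact ⟨mul_le_mul hw hv' (norm_nonneg _) hR, mul_le_mul hw hd' (norm_nonneg _) hR⟩
  · obtain ⟨h0, h1⟩ := hz (lt_of_not_ge hy)
    have hR : 0 ≤ (1 + Φ.rOut) ^ 2 * (M + 1) := by positivity
    refine ⟨?_, ?_⟩
    · show (1 + ‖y‖) ^ 2 * ‖(a * Real.cos (k * ⟪e, y⟫_ℝ) * Φ y) • e‖ ≤ (1 + Φ.rOut) ^ 2 * (M + 1)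
      rw [h0, norm_zero, mul_zero]; exact hR
    · rw [h1, norm_zero, mul_zero]; exact hR

/-- Closeness of two data fields (different amplitude and frequency), uniformly in space. [folklore] -/
theorem dataField_close (Φ : ContDiffBump (0 : EuclideanSpace ℝ (Fin 3))) {e : EuclideanSpace ℝ (Fin 3)} (he : ‖e‖ = 1)
    (a a' k k' : ℝ) (y : EuclideanSpace ℝ (Fin 3)) :
    ‖(a * Real.cos (k * ⟪e, y⟫_ℝ) * Φ y) • e - (a' * Real.cos (k' * ⟪e, y⟫_ℝ) * Φ y) • e‖ ≤
      |a - a'| + |a'| * (|k - k'| * Φ.rOut) := by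
  have hnn : 0 ≤ |a - a'| + |a'| * (|k - k'| * Φ.rOut) := by
    have := Φ.rOut_pos.le; positivity
  by_cases hΦ : Φ y = 0
  · rw [hΦ]; simpa using hnn
  · have hy : ‖y‖ < Φ.rOut := by
      have : y ∈ Function.support (Φ : EuclideanSpace ℝ (Fin 3) → ℝ) := Function.mem_support.mpr hΦ
      rw [Φ.support_eq, Metric.mem_ball, dist_zero_right] at this
      exact this
    have hu : |⟪e, y⟫_ℝ| ≤ Φ.rOut := le_trans (abs_real_inner_le_norm _ _) (by rw [he, one_mul]; exact le_of_lt hy)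
    have hΦ1 : |Φ y| ≤ 1 := by rw [abs_of_nonneg Φ.nonneg]; exact Φ.le_one
    rw [← sub_smul, norm_smul, he, mul_one, Real.norm_eq_abs,
      show a * Real.cos (k * ⟪e, y⟫_ℝ) * Φ y - a' * Real.cos (k' * ⟪e, y⟫_ℝ) * Φ y =
        ((a - a') * Real.cos (k * ⟪e, y⟫_ℝ) + a' * (Real.cos (k * ⟪e, y⟫_ℝ) - Real.cos (k' * ⟪e, y⟫_ℝ))) * Φ y by ring,
      abs_mul]
    have h1 : |(a - a') * Real.cos (k * ⟪e, y⟫_ℝ)| ≤ |a - a'| := by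
      rw [abs_mul]; exact le_trans (mul_le_mul_of_nonneg_left (Real.abs_cos_le_one _) (abs_nonneg _)) (le_of_eq (mul_one _))
    have h2 : |a' * (Real.cos (k * ⟪e, y⟫_ℝ) - Real.cos (k' * ⟪e, y⟫_ℝ))| ≤ |a'| * (|k - k'| * Φ.rOut) := by
      rw [abs_mul]
      refine mul_le_mul_of_nonneg_left ?_ (abs_nonneg _)
      refine le_trans (Real.abs_cos_sub_cos_le _ _) ?_
      rw [show k * ⟪e, y⟫_ℝ - k' * ⟪e, y⟫_ℝ = (k - k') * ⟪e, y⟫_ℝ by ring, abs_mul]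
      exact mul_le_mul_of_nonneg_left hu (abs_nonneg _)
    calc |(a - a') * Real.cos (k * ⟪e, y⟫_ℝ) + a' * (Real.cos (k * ⟪e, y⟫_ℝ) - Real.cos (k' * ⟪e, y⟫_ℝ))| * |Φ y|
        ≤ (|a - a'| + |a'| * (|k - k'| * Φ.rOut)) * 1 :=
          mul_le_mul (le_trans (abs_add_le _ _) (add_le_add h1 h2)) hΦ1 (abs_nonneg _) hnn
      _ = |a - a'| + |a'| * (|k - k'| * Φ.rOut) := mul_one _

/-- THE SPIKE FUNCTIONAL AT THE DATA of matching frequency: `∫ φ sin(kt) ∂_t⟪G(te),e⟫ = −∫ φ sin²(kt)` when `a·k = 1` and the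
bump `Φ` is `≡ 1` along the segment carrying `φ`. [folklore] -/
theorem spike_on_data (φ : ContDiffBump (0:ℝ)) (Φ : ContDiffBump (0 : EuclideanSpace ℝ (Fin 3))) (hr : φ.rOut ≤ Φ.rIn)
    {e : EuclideanSpace ℝ (Fin 3)} (he : ‖e‖ = 1) {a k : ℝ} (hak : a * k = 1) :
    ∫ t, φ t * Real.sin (k * t) *
        ⟪fderiv ℝ (fun y : EuclideanSpace ℝ (Fin 3) => (a * Real.cos (k * ⟪e, y⟫_ℝ) * Φ y) • e) (t • e) e, e⟫_ℝ =
      -∫ t, φ t * Real.sin (k * t) ^ 2 := by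
  rw [← integral_neg]
  refine integral_congr_ae (Eventually.of_forall fun t => ?_)
  by_cases hφ : φ t = 0
  · simp [hφ]
  · have ht : |t| < φ.rOut := by
      have : t ∈ Function.support (φ : ℝ → ℝ) := Function.mem_support.mpr hφ
      rw [φ.support_eq, Metric.mem_ball, Real.dist_eq, sub_zero] at this
      exact this
    have hee : ⟪e, e⟫_ℝ = 1 := by rw [real_inner_self_eq_norm_sq, he]; norm_num
    have hte : ⟪e, t • e⟫_ℝ = t := by rw [real_inner_smul_right, hee, mul_one]
    have hmem : t • e ∈ Metric.ball (0 : EuclideanSpace ℝ (Fin 3)) Φ.rIn := by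
      rw [Metric.mem_ball, dist_zero_right, norm_smul, he, mul_one, Real.norm_eq_abs]; linarith
    have hΦ1 : Φ (t • e) = 1 := Φ.one_of_mem_closedBall (Metric.ball_subset_closedBall hmem)
    have hΦ0 : fderiv ℝ (Φ : EuclideanSpace ℝ (Fin 3) → ℝ) (t • e) = 0 := by
      rw [(Φ.eventuallyEq_one_of_mem_ball hmem).fderiv_eq]
      exact fderiv_const_apply _
    have hD : ⟪fderiv ℝ (fun y : EuclideanSpace ℝ (Fin 3) => (a * Real.cos (k * ⟪e, y⟫_ℝ) * Φ y) • e) (t • e) e, e⟫_ℝ =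
        -(a * k) * Real.sin (k * t) := by
      rw [(dataField_hasFDerivAt Φ a k e (t • e)).fderiv, hΦ0, hΦ1, hte]
      simp only [smul_zero, zero_add, one_smul, ContinuousLinearMap.smulRight_apply, FunLike.coe_smul,
        Pi.smul_apply, innerSL_apply_apply, hee, smul_eq_mul, mul_one, real_inner_smul_left]
      ring
    show φ t * Real.sin (k * t) *
        ⟪fderiv ℝ (fun y : EuclideanSpace ℝ (Fin 3) => (a * Real.cos (k * ⟪e, y⟫_ℝ) * Φ y) • e) (t • e) e, e⟫_ℝ =
      -(φ t * Real.sin (k * t) ^ 2)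
    rw [hD, hak]; ring

/-- The window integral of `sin²` at frequency `k ≥ 2π` over a bump equal to `1` on `[−1,1]` is at least `1/2`. [folklore] -/
theorem half_le_integral_bump_sin_sq (φ : ContDiffBump (0:ℝ)) (h1 : 1 ≤ φ.rIn) {k : ℝ} (hk : 2 * π ≤ k) :
    1 / 2 ≤ ∫ t, φ t * Real.sin (k * t) ^ 2 := by
  have hπ : 0 < π := Real.pi_pos
  have hk0 : 0 < k := lt_of_lt_of_le (by positivity) hk
  have hk2 : 2 ≤ k := le_trans (by nlinarith [Real.pi_gt_three]) hk
  -- the explicit window integral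
  have hI : ∫ t in (-1:ℝ)..1, Real.sin (k * t) ^ 2 = 1 - Real.sin k * Real.cos k / k := by
    have := intervalIntegral.integral_comp_mul_left (fun u => Real.sin u ^ 2) (ne_of_gt hk0) (a := -1) (b := 1)
    rw [this, integral_sin_sq]
    simp only [mul_neg, mul_one, Real.sin_neg, Real.cos_neg, smul_eq_mul]
    field_simp
    ring
  have hIge : 1 / 2 ≤ ∫ t in (-1:ℝ)..1, Real.sin (k * t) ^ 2 := by
    rw [hI]
    have hsc : Real.sin k * Real.cos k / k ≤ 1 / 2 := by
      rw [div_le_iff₀ hk0]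
      nlinarith [Real.sin_le_one k, Real.cos_le_one k, Real.neg_one_le_sin k, Real.neg_one_le_cos k,
        Real.sin_sq_add_cos_sq k]
    linarith
  -- compare with the whole-line integral against the bump
  have hint : Integrable (fun t => φ t * Real.sin (k * t) ^ 2) :=
    (φ.continuous.mul ((Real.continuous_sin.comp (continuous_const.mul continuous_id)).pow 2)).integrable_of_hasCompactSupport
      φ.hasCompactSupport.mul_right
  have hnn : 0 ≤ᵐ[volume] fun t => φ t * Real.sin (k * t) ^ 2 :=
    Eventually.of_forall fun t => mul_nonneg φ.nonneg (sq_nonneg _)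
  have hset : ∫ t in Ioc (-1:ℝ) 1, φ t * Real.sin (k * t) ^ 2 = ∫ t in Ioc (-1:ℝ) 1, Real.sin (k * t) ^ 2 := by
    refine setIntegral_congr_fun measurableSet_Ioc fun t ht => ?_
    have hmem : t ∈ Metric.closedBall (0:ℝ) φ.rIn := by
      rw [Metric.mem_closedBall, Real.dist_eq, sub_zero]
      exact le_trans (abs_le.mpr ⟨by linarith [ht.1], ht.2⟩) h1
    simp [φ.one_of_mem_closedBall hmem]
  calc 1 / 2 ≤ ∫ t in (-1:ℝ)..1, Real.sin (k * t) ^ 2 := hIge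
    _ = ∫ t in Ioc (-1:ℝ) 1, φ t * Real.sin (k * t) ^ 2 := by rw [intervalIntegral.integral_of_le (by norm_num), hset]
    _ ≤ ∫ t, φ t * Real.sin (k * t) ^ 2 := setIntegral_le_integral hint hnn


/-- Frequencies `2π/q`, `2π/p` differ by `2π|q−p|/(qp)`. [folklore] -/
theorem abs_freq_sub {p q : ℝ} (hp : 0 < p) (hq : 0 < q) :
    |2 * π * q⁻¹ - 2 * π * p⁻¹| = 2 * π * |q - p| / (q * p) := by
  rw [← mul_sub, inv_sub_inv hq.ne' hp.ne', abs_mul, abs_of_pos (by positivity : (0:ℝ) < 2 * π), abs_div,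
    abs_of_pos (mul_pos hq hp), abs_sub_comm, mul_div_assoc]

end Summit.NavierStokesRegularity.NavierStokesRegularity.Theorems.KelvinGate
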